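import Summits.QuantumFields.YangMills.Theorems.BalabanUVNodesN18BackgroundPlaqOfRecordSpace
import Literature.MathematicalPhysics.QuantumFieldTheory.Balaban1983to89.B16Ineq197ClassOne
import HarnessLib

/-!
# BalabanUVNodes ∕ node N18 = NE5 — closure-ledger item (iii): THE WHOLE TORUS IS A LOCALIZATION DOMAIN OF RECORD AND ITS CUBES COVER EVERY SITE —
# THE PLAQUETTE COVER `hcover` OF THE TRANSPORT-CLAUSE KNIT DISCHARGED AT LEVEL `j = 0`
# (Track A, DAG node N18 = `T4OutputRate.NE5` :211; cluster K4 «SpineRates», item K3⁷ `SpineGivenEndpointR13SepCoPH`; seat pub-ymgap-dag-n18-w3 g3)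

HONEST FRAMING.  Count-neutral kernel bookkeeping (`--supports stmt-QuantumFields-20544 --as helper`): elementary lattice geometry of def-R ∕ def-T's domain
system `Sect2.domSys P M j = TreeLengthTorus.tsys P.d (domCount P M j)` (the full index torus is non-empty and wall-connected — the image of a box of `ℤᵈ`,
`B16Ineq197ClassOne.faceConnected_pbox` + `TreeLengthTorus.tFaceConnected_image` — and the `M·Lʲ`-cubes indexed by it cover the fine torus), PROVED; then
FILE 5's knit (`…N18BackgroundPlaqOfRecordSpace`) with its plaquette cover DISCHARGED at level `0`.  The analysis input (T3) `hsat` stays displayed; nothing of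
Bałaban's RG asserted; NE5 NOT PRINTED ∕ NOT proved; N18 NOT discharged; nothing about the continuum ∕ OS ∕ mass gap ∕ Clay.

WHAT.
* §1 `image_proj_pbox_eq_univ` (the box `[0, c−1]ᵈ ⊂ ℤᵈ` projects ONTO `(ℤ∕c)ᵈ`), ★ `isTDom_univ` (the whole torus is a localization domain:
  `IsTDom (univ : Finset (TPt d c))`).
* §2 ★ `mem_domSites_univ` (for `0 < M` every fine site lies in the site set of the whole-torus domain at every level `j`: the cube of index
  `⌊val(y_i)∕(M·Lʲ)⌋`), `mem_plaqInside_domSites_univ` (hence every plaquette lies inside it), ★ `plaqCover_domSys` (FILE 5's `hcover` with `a := α₀ 0`,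
  at `j = 0`, `η_0 = 1`).
* §3 ★★★ `admTransport_spaceOfRecord_unit_ofRecord_orbit_of_top` — BOTH transport clauses of N18's reading at the table of record from: `hGc` (run B's `Gᶜ`
  inside run A's), `0 < M`, the smallness of run B's TOP radius `0 ≤ α₀(k+1)(0)`, `((d+2)L)²·α₀(k+1)(0)∕4 < δ_N` ([Balaban1985Averaging] Prop. 1's chart
  guard), `hα` (run A's radii positive), and the analysis input `hsat` ((T3) in orbit form at the unit recipe).  W1-18's «remaining by name» list for the
  transports of record is thereby reduced to `hsat` alone (plus numerics).

0 `def`, 0 `sorry`.  References: T. Bałaban, CMP **109** (1987) 249–301 [Balaban1987RG1] (p.257 (localization domains 𝐃_j), (1.10)–(1.16) p.262);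
CMP **98** (1985) 17–51 [Balaban1985Averaging] (Prop. 1 (51) p.26); CMP **119** (1988) 243–285 [Balaban1988Convergent] ((2.17) p.257).
-/

noncomputable section

open Set
open scoped Matrix.Norms.L2Operator

namespace YMDAG.N18.TransportOfRecord

open Literature.MathematicalPhysics.QuantumFieldTheory.Balaban1983to89
open Literature.MathematicalPhysics.QuantumFieldTheory.Balaban1983to89.T4Continuum
open Literature.MathematicalPhysics.QuantumFieldTheory.Balaban1983to89.TreeLengthTorus (TPt proj proj_apply TFaceConnected IsTDom tFaceConnected_image)
open Literature.MathematicalPhysics.QuantumFieldTheory.Balaban1983to89.B16Absorption (pbox mem_pbox)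
open Literature.MathematicalPhysics.QuantumFieldTheory.Balaban1983to89.B16Ineq197ClassOne (faceConnected_pbox)
open Literature.MathematicalPhysics.QuantumFieldTheory.Balaban1983to89.B12RegularSpaces111
open Literature.MathematicalPhysics.QuantumFieldTheory.Balaban1983to89.Node00 (MatA ιSU plaqInside cubeEnl)
open Literature.MathematicalPhysics.QuantumFieldTheory.Balaban1983to89.Node00.Sect2 (domSys domSites domCount liftIdx CPair ofBackgroundC embedPair spaceI frameI Setting Residual)
open Literature.MathematicalPhysics.QuantumFieldTheory.Balaban1983to89.Node00.W1
open Literature.MathematicalPhysics.QuantumFieldTheory.Balaban1983to89.B15Eq112TorusCover (cover cover_apply)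
open Literature.MathematicalPhysics.QuantumFieldTheory.Balaban1983to89.B14.Eq213MaximalDomains (side cubeExt)
open Literature.MathematicalPhysics.QuantumFieldTheory.Balaban1983to89.ExpMeanLog (deltaSU)
open Summit.QuantumFields.BalabanUV.T4Continuum.B13Carriers (transportRaw)

/-! ## §1 The whole torus is a localization domain -/

section Torus

/-- The box `[0, c−1]ᵈ ⊂ ℤᵈ` projects onto the whole index torus `(ℤ∕c)ᵈ`. [folklore] -/
theorem image_proj_pbox_eq_univ (d c : ℕ) [NeZero c] :
    (pbox (fun _ : Fin d => (0 : ℤ)) (fun _ => (c : ℤ) - 1)).image (proj c) = Finset.univ := by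
  classical
  apply Finset.eq_univ_of_forall
  intro t
  refine Finset.mem_image.2 ⟨fun i => ((t i).val : ℤ), ?_, ?_⟩
  · rw [mem_pbox]
    intro i
    have h := ZMod.val_lt (t i)
    constructor
    · exact_mod_cast Nat.zero_le _
    · have : ((t i).val : ℤ) < c := by exact_mod_cast h
      linarith
  · funext i
    rw [proj_apply, Int.cast_natCast, ZMod.natCast_zmod_val]

/-- ★ **THE WHOLE TORUS IS A LOCALIZATION DOMAIN**: the full family of cube indices is non-empty and wall-connected (`IsTDom univ`), as the projection of a
box of `ℤᵈ` — so `⟨univ, isTDom_univ d c⟩` is a domain of `TreeLengthTorus.tsys d c` = `Sect2.domSys` (print: the torus `T` itself is the largest `X ∈ 𝐃_j`).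
[cite: Balaban1987RG1, p.257 (localization domains)] -/
theorem isTDom_univ (d c : ℕ) [NeZero c] : IsTDom (Finset.univ : Finset (TPt d c)) := by
  refine ⟨Finset.univ_nonempty, ?_⟩
  rw [← image_proj_pbox_eq_univ d c]
  exact tFaceConnected_image (faceConnected_pbox _ _)

end Torus

/-! ## §2 The cubes of the whole-torus domain cover every fine site -/

section Cover

variable {P : Params} {M : ℕ}

/-- ★ **EVERY FINE SITE LIES IN THE SITE SET OF THE WHOLE-TORUS DOMAIN** at every level `j` (`0 < M`): `y` lies in the `M·Lʲ`-cube of index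
`a_i = ⌊val(y_i)∕(M·Lʲ)⌋ < domCount`. [cite: Balaban1987RG1, p.257 («every localization domain X is a union of … cubes from π_j»)] -/
theorem mem_domSites_univ (hM : 0 < M) (j : ℕ) (y : Site P 0) :
    y ∈ domSites P M j ⟨Finset.univ, isTDom_univ P.d (domCount P M j)⟩ := by
  classical
  have hs : 0 < side P.L M j := Nat.mul_pos (pow_pos P.L_pos j) hM
  set s := side P.L M j with hsdef
  -- the cube index of `y`
  have hlt : ∀ i, (y i).val / s < domCount P M j := fun i => by
    have hv : (y i).val ≤ P.sitesPerDir 0 - 1 := Nat.le_sub_one_of_lt (ZMod.val_lt (y i))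
    exact Nat.lt_succ_of_le (Nat.div_le_div_right hv)
  unfold domSites
  refine Set.mem_iUnion₂.2 ⟨fun i => (((y i).val / s : ℕ) : ZMod (domCount P M j)), Finset.mem_univ _, ?_⟩
  refine ⟨fun i => ((y i).val : ℤ), fun i => ?_, ?_⟩
  · have hli : liftIdx P (fun i => (((y i).val / s : ℕ) : ZMod (domCount P M j))) i = (((y i).val / s : ℕ) : ℤ) := by
      simp only [liftIdx, ZMod.val_natCast, Nat.mod_eq_of_lt (hlt i)]
    rw [hli]
    have h1 : s * ((y i).val / s) ≤ (y i).val := Nat.mul_div_le _ _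
    have h2 : (y i).val < s * ((y i).val / s) + s := by
      have := Nat.lt_div_mul_add (a := (y i).val) hs
      linarith [Nat.mul_comm ((y i).val / s) s]
    constructor
    · push_cast; linarith [show ((s * ((y i).val / s) : ℕ) : ℤ) ≤ (y i).val by exact_mod_cast h1]
    · have h2' : (((y i).val : ℕ) : ℤ) < ((s * ((y i).val / s) + s : ℕ) : ℤ) := by exact_mod_cast h2
      push_cast at h2' ⊢
      linarith
  · funext μ
    rw [cover_apply, Int.cast_natCast, ZMod.natCast_zmod_val]

/-- Hence every plaquette of the fine torus lies INSIDE the site set of the whole-torus domain. [cite: Balaban1988Convergent, (2.17) p.257] -/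
theorem mem_plaqInside_domSites_univ (hM : 0 < M) (j : ℕ) (q : Plaq P 0) :
    q ∈ plaqInside (domSites P M j ⟨Finset.univ, isTDom_univ P.d (domCount P M j)⟩) :=
  ⟨mem_domSites_univ hM j _, mem_domSites_univ hM j _, mem_domSites_univ hM j _, mem_domSites_univ hM j _⟩

/-- ★ **THE PLAQUETTE COVER OF FILE 5 (`hcover`), DISCHARGED AT LEVEL `0`**: every plaquette lies inside the whole-torus domain at `j = 0`, where `η_0 = 1`, so the
cover holds with the bound `a := α₀ 0`. [cite: Balaban1987RG1, p.257 (localization domains), (1.1) p.260] -/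
theorem plaqCover_domSys (hM : 0 < M) (α₀ : ℕ → ℝ) :
    ∀ q : Plaq P 0, ∃ (j : ℕ) (Y : (domSys P M j).Dom), q ∈ plaqInside (domSites P M j Y) ∧ α₀ j * P.eta j ^ 2 ≤ α₀ 0 :=
  fun q => ⟨0, ⟨Finset.univ, isTDom_univ P.d (domCount P M 0)⟩, mem_plaqInside_domSites_univ hM 0 q, by simp [Params.eta]⟩

end Cover

/-! ## §3 FILE 5's knit with the plaquette cover discharged: the two transport clauses from `hsat` and numerics alone -/

section Record

variable (F : T4Family) (N M k : ℕ) [NeZero N]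

/-- ★★★ **BOTH TRANSPORT CLAUSES OF N18's READING AT THE TABLE OF RECORD FROM (T3) IN ORBIT FORM AND NUMERICS ALONE**: FILE 5's
`admTransport_spaceOfRecord_unit_ofRecord_orbit_of_cover` with `hcover` PROVED (§2, `a := α₀(k+1)(0)`).  Displayed: `hGc` (run B's `Gᶜ` inside run A's —
`le_rfl` at a run-constant setting), `0 < M`, `0 ≤ α₀(k+1)(0)`, the chart guard `((d+2)L)²·α₀(k+1)(0)∕4 < δ_N` of [Balaban1985Averaging] Prop. 1 on run B's
top radius, `hα` (run A's radii positive), ★ `hsat` ((T3) in orbit form at the unit recipe — the consequent SHAPE of `…N18CombStepOrbitFrame`'s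
`exists_orbit_comb_firstOrder_frameI_su`).  Conclusion: the table clause `hTsp` of W1-14's germ faces ∕ module 20 AND the background clause `hT₀` of
`LevelPairing.ofRecordAdm` at run length `k`, for W1-18's transports of record. [cite: Balaban1987RG1, (0.21)-(0.25) pp.256-257, (1.10)-(1.16) p.262; Balaban1985Averaging, Prop. 1 (51) p.26] -/
theorem admTransport_spaceOfRecord_unit_ofRecord_orbit_of_top (Sg : ℕ → Setting (MatA N) (Node00.SU N)) (α₀ α₁ : ℕ → ℕ → ℝ)
    (hGc : (Sg (k + 1)).𝓜.Gc ≤ (Sg k).𝓜.Gc) (hM : 0 < M) (ha : 0 ≤ α₀ (k + 1) 0)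
    (haδ : (((((F.P (k + 1)).d + 2) * (F.P (k + 1)).L : ℕ) : ℝ) ^ 2 / 4) * α₀ (k + 1) 0 < deltaSU (Fin N))
    (hα : ∀ j, 0 < α₀ k j)
    (hsat : ∀ (j : ℕ) (Y : (domSys (F.P k) M j).Dom) (Φ : FieldPair (F.P (k + 1)) 0 (MatA N)ˣ (MatA N)),
      SatisfiesI_III (Sg (k + 1)).𝓜 (frameI (Residual.unit (F.P (k + 1)) (MatA N)) M (j + 1) (domSites (F.P (k + 1)) M (j + 1) (pairOfRecord F M k ⟨j, Y⟩).2))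
          (StepConsts.ofParams (F.P (k + 1)) (Sg (k + 1)).cB (j + 1)) (α₀ (k + 1) (j + 1)) (α₁ (k + 1) (j + 1)) (α₀ (k + 1) (j + 1)) Φ →
        ∃ w : Site (F.P k) 0 → (MatA N)ˣ, (∀ x, w x ∈ (Sg k).𝓜.Gc) ∧
          SatisfiesI_III (Sg k).𝓜 (frameI (Residual.unit (F.P k) (MatA N)) M j (domSites (F.P k) M j Y)) (StepConsts.ofParams (F.P k) (Sg k).cB j) (α₀ k j)
            (α₁ k j) (α₀ k j) (act w (TΦOfRecord F N k Φ))) :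
    (∀ (X : Node00.W1.Dom (F.P k) M) (ψ : CPair (F.P (k + 1)) (MatA N)),
        ψ ∈ spaceOfRecord (M := M) (Sg (k + 1)) (Residual.unit (F.P (k + 1)) (MatA N)) (α₀ (k + 1)) (α₁ (k + 1)) (pairOfRecord F M k X).1
            (pairOfRecord F M k X).2 →
          TcfgOfRecord F N k ψ ∈ spaceOfRecord (M := M) (Sg k) (Residual.unit (F.P k) (MatA N)) (α₀ k) (α₁ k) X.1 X.2) ∧
      ∀ U : GaugeField (F.P (k + 1)) 0 (Node00.SU N),
        (∀ (j : ℕ) (Y : (domSys (F.P (k + 1)) M j).Dom),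
            ofBackgroundC (ιSU N) U ∈ spaceOfRecord (M := M) (Sg (k + 1)) (Residual.unit (F.P (k + 1)) (MatA N)) (α₀ (k + 1)) (α₁ (k + 1)) j Y) →
          ∀ (j : ℕ) (Y : (domSys (F.P k) M j).Dom),
            ofBackgroundC (ιSU N) (transportRaw F k (Node00.avOfRecord F N (k + 1) 0) U) ∈
              spaceOfRecord (M := M) (Sg k) (Residual.unit (F.P k) (MatA N)) (α₀ k) (α₁ k) j Y :=
  admTransport_spaceOfRecord_unit_ofRecord_orbit_of_cover F N M k Sg α₀ α₁ hGc ha haδ (plaqCover_domSys hM (α₀ (k + 1))) hα hsat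

end Record

end YMDAG.N18.TransportOfRecord

end
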